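import Summits.QuantumFields.YangMills.Theorems.BalabanUVNodesN07ChartDValued
import Literature.MathematicalPhysics.QuantumFieldTheory.Balaban1983to89.B9AdOrthogonal
import Literature.MathematicalPhysics.QuantumFieldTheory.Balaban1983to89.B7Prop2Explicit
import Literature.MathematicalPhysics.QuantumFieldTheory.Balaban1983to89.T4AdjointCovarianceUnitary
import Summits.QuantumFields.YangMills.Theorems.BalabanUVNodesK0UniformFluxConfig
import HarnessLib

/-!
# BalabanUVNodes ∕ N07 — REALITY OF THE CHART `chartLog`: for Hermitian traceless `A` (print's `𝔤`, `U₁ = e^{iηA}`) on the weighted ball, the multi-level data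
# `B(j, c) = (1∕i)·log Ū^{(j)}(e^{iηA})(c)` of (156) is Hermitian traceless — because the unguarded complex averages of the chart AGREE with the tree's guarded
# `SU(N)` (0.4) averages on the reading window (a local dictionary), so `Ū^{(j)}(e^{iηA})(c) ∈ SU(N)` near `1`; hence (hSlog) of `N07ChartDValued` at `𝔤`

Cell `pub-ymgap`, width seat `pub-ymgap-dag-n07-w2` generation 3 (HUMAN RULING D-0149; DAG node N07 = [15] = [Balaban1985Variational]; W-SEAT START LIST §n07 item 2 = S2
«[15] Sect. C (47)–(49), Prop. 3 AT OBJECTS»).  `--kind proof --supports stmt-QuantumFields-20542 --as helper` (K1⁷; count-neutral).  CONSUMED BY NAME, nothing modified: the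
route `UnitScaleTilt`'s `Prop8Chart.{expCfg, emlAvgU, emlIterU, chartLog, coe_emlAvgU_unitsField, emlAvgU_congr₂, norm_emlIterU_sub_one_le_of_reads, collar_of_adm22}`
(pillar P3: the chart, ITS ONE-STEP DICTIONARY WITH THE GUARDED AVERAGE on the guard, two-block locality, the k-uniform near-flatness of the iterated average), the tree's
`BlockAveraging.{Small, loopHol, blockAvg, avgFun, blockOf_src_of_mem_walk}`, `T4ReflectionConeSharp.blockOf_tgt_of_mem_walk`, `LatticeWordStokes.length_loopWord_le`,
`ExpMeanLog.{expMeanLogSU, deltaSU, trace_mlog_eq_zero}`, `B7Prop2Explicit.star_mlog_eq_neg`, `T4AdjointCovarianceUnitary.{lieSU, exp_mem_specialUnitaryGroup_of_mem_lieSU}`,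
`B9AdOrthogonal.herm0` (the physicists' `𝔰𝔲(N)`: traceless Hermitian matrices), `B10Eq27TorusAxialLog.{unitsField, toUField}`, dag k0's
`K0UniformFluxConfig.dist1_holAt_le_length_mul`, this seat's
`N07ChartRemainderP.norm_expCfg_sub_one_le_of_weightedBall` and `N07ChartDValued.chartD_valued_of_chartLog`.

THE PRINT: [15] (152) p. 301 «U₁ = e^{iηA}, A with values in 𝔤», (156) p. 302 «Q_j(ηA) = B on Λ′_j … B = (1∕i) log V₁»; [I] (0.4) p. 253 «for a set {U_j} of elements close
to the identity of the group … exp[mean (1∕i) log]».  The complex chart of pillar P3 (`emlIterU`, `mlog` the principal matrix logarithm on `M_N(ℂ)ˣ`) is the analytic continuation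
of the guarded `SU(N)` average `BlockAveraging.blockAvg expMeanLogSU` (guard `δ_N = min(1∕3, π∕N)` on the (0.4) loop variables); on `SU(N)`-valued small fields the two coincide
(`coe_emlAvgU_unitsField`, one step).  This file iterates that identity down the reading window of an index bond and reads off the reality of `chartLog`.

WHAT IS PROVED (sorry-free; no definition; axioms standard; generic `P`, `N ≥ 1`).
* §1 ★★★ `emlIterU_unitsField_eq_iter_of_reads` — THE LOCAL DICTIONARY: for an `SU(N)` field `U` on `T^{(0)}`, a level `j ≤ m + K`, a `j`-bond `e`, and `s₀ ≥ 0` with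
  `6400ℓ²Lʲs₀ ≤ 1` and the guard budget `30ℓ²Lʲs₀ < δ_N`: if `‖U(b) − 1‖ ≤ s₀` on the fine bonds under the two `j`-blocks of `e`, then for EVERY level `i ≤ j` and every `i`-bond
  `b` under `e` (both ends), `emlIterU i (unitsField (toUField U)) b = unitsField (toUField (Ū^{(i)} U)) b` with `Ū^{(i)} = Averaging.iter (blockAvg expMeanLogSU) i` THE TREE'S
  GUARDED (0.4) AVERAGE (the averaging of record `Node00.avOfRecord` is this map, `avOfRecord_apply`), and `‖Ū^{(i)}U(b) − 1‖ ≤ 30ℓLⁱs₀` — induction on `i`: two-block locality,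
  the guard `Small` at each `(i+1)`-bond from dag k0's `K0UniformFluxConfig.dist1_holAt_le_length_mul` + the k-uniform near-flatness, then the one-step dictionary.
* §2 ★★★ `chartLog_mem_herm0` — for a nested family `D` (`D.k = k`, collar), level weights `w`, the weighted ball `w₁(b)‖A(b)‖ < R` with `12800ℓ²LR ≤ 1` and the guard budget
  `60ℓ²LR < δ_N`, and `A` HERMITIAN TRACELESS at every bond: `chartLog η D A (j, c)` is Hermitian traceless at every index — with ★ `coe_emlIterU_expCfg_eq_iter` (the charted
  field's complex averages ARE the guarded `SU(N)` averages of the `SU(N)` field `e^{iηA}` at every index bond, within `60ℓLR` of `1`).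
* §3 ★★★ `chartD_valued_herm0` — (hSlog) of `N07ChartDValued.chartD_valued_of_chartLog` DISCHARGED at `S = herm0`: under the binders of that theorem (H with the (46) letter,
  `18C₂B₀ε ≤ 1`, `64ε ≤ R⋆`), the value-module conjunct (hSH) of `H` at `herm0` (displayed) and the guard budget `120ℓ²Lε < δ_N`: for ANY `Dfun` with (55)+(49), Hermitian
  traceless `A′` in the ball ⇒ `Dfun A′` and `A′ − H·Dfun A′` Hermitian traceless.

HONEST FRAMING: (hSH) — the `herm0`-invariance of the right inverse of record — remains DISPLAYED (asked of dag k0-s1-w1 on the bus; UST `ChartHInv.exists_rightInverse` is an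
ℝ-combination construction); the guard budget is `N`-dependent through `δ_N = min(1∕3, π∕N)` exactly as the tree's (0.4) guard is (it cannot be dropped for the traceless part:
`e^{2πi∕7}·1 ∈ SU(7)` has `‖W − 1‖ < 1` and `tr log W = 2πi`; for `N = 2`, `δ_2 = 1∕3` and the budget is implied by the `ε`-window up to the displayed numeric inequality); nothing
of [15] Sects. D–F asserted; stub 1 ∕ K0⁷ ∕ K1⁷ NOT closed; N07 NOT discharged; counts unmoved (5∕28); one finite T⁴ programme at fixed ε — NOT continuum ∕ ℝ⁴ ∕ OS ∕ mass gap ∕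
Clay: the Yang–Mills mass gap is NOT proved by any of this; R4 closes the conditional rung `BalabanLadder.UV` only.  No `sorry`, no `def`, no `instance`, no `notation`.

References: [15] T. Bałaban, CMP 102 (1985) 277–309 [Balaban1985Variational] ((43)–(49) p.285, (152)–(157) pp.301–302, Prop. 3 p.289); [I] T. Bałaban, CMP 109 (1987) 249–301
[Balaban1987RG1] ((0.4)–(0.7) p.253, (0.11) p.253); T. Bałaban, CMP 98 (1985) 17–51 [Balaban1985Averaging] ((19)–(26) pp.21–22, Prop. 4 p.38).
-/

noncomputable section

open scoped BigOperators Matrix.Norms.L2Operator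
open NormedSpace Metric Set

namespace Summit.QuantumFields.YangMills.BalabanUVNodes.N07ChartLogReality

open Literature.MathematicalPhysics.QuantumFieldTheory.Balaban1983to89
open T4Continuum BlockAveraging ExpMeanLog MatrixLog
open B10Eq27TorusAxialLog (unitsField toUField val_unitsField)
open B5Eq118OneStroke (iterBlockOf iterBlockOf_succ iterBlockOf_zero)
open B6SectADomainsV1 (Domains)
open B6SectAOperatorsV1 (BondIdx)
open B9AdOrthogonal (herm0 mem_herm0)
open T4AdjointCovarianceUnitary (lieSU mem_lieSU_iff exp_mem_specialUnitaryGroup_of_mem_lieSU)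
open BlockAveragingEMLLinearised (length_walk)
open LatticeWordStokes (length_loopWord_le)
open Summit.QuantumFields.YangMills.Theorems.Prop8Chart
open Summit.QuantumFields.YangMills.Theorems.FlatCubeOpsText (Adm22)
open Summit.QuantumFields.YangMills.Theorems.K0FlatCubeOpsTextP (IsLevWeight)
open Summit.QuantumFields.YangMills.Theorems.K0UniformFluxConfig (dist1_holAt_le_length_mul)
open Summit.QuantumFields.YangMills.BalabanUVNodes.N07ChartRemainderP (norm_expCfg_sub_one_le_of_weightedBall)
open Summit.QuantumFields.YangMills.BalabanUVNodes.N07ChartDValued (chartD_valued_of_chartLog)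

variable {P : Params}

/-! ## §1 The local dictionary: the chart's unguarded averages of an `SU(N)` field are the guarded (0.4) averages, down the reading window -/

section Dictionary

variable {N : ℕ} [NeZero N]

/-- ★★★ **THE LOCAL DICTIONARY.**  `U` an `SU(N)` field on the finest lattice, `j ≤ m + K`, `e` a `j`-bond, `s₀ ≥ 0` with `6400ℓ²Lʲs₀ ≤ 1` and the guard budget `30ℓ²Lʲs₀ < δ_N`
(`δ_N = min(1∕3, π∕N)`, `ℓ = (d+2)L`); assume `‖U(b) − 1‖ ≤ s₀` for every fine bond `b` whose `j`-block point `Bʲ(b₋)` is an end of `e`.  Then for every `i ≤ j` and every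
`i`-bond `b` BELOW `e` (every fine site over `b₋`, resp. `b₊`, has its `j`-block point among the ends of `e`): the unguarded complex average of pillar P3 and the tree's guarded
`SU(N)` (0.4) average agree, `emlIterU i (unitsField (toUField U)) b = unitsField (toUField (Averaging.iter (blockAvg expMeanLogSU) i U)) b`, and `‖Ū^{(i)}U(b) − 1‖ ≤ 30ℓLⁱs₀`.
Induction on `i`: two-block locality (`emlAvgU_congr₂`), the guard `Small` at the next bond from `dist1_holAt_le_length_mul` and the k-uniform near-flatness `norm_emlIterU_sub_one_le_of_reads` (loop length
`≤ ℓ`, so the loop variables are within `30ℓ²Lʲs₀ < δ_N` of `1`), then `coe_emlAvgU_unitsField`. [cite: Balaban1987RG1, (0.4) p.253, (0.11) p.253; Balaban1985Averaging, Prop. 4 p.38;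
Balaban1985Variational, (152) (156) pp.301-302] -/
theorem emlIterU_unitsField_eq_iter_of_reads {j : ℕ} (hj : j ≤ P.m + P.K) (U : GaugeField P 0 (Matrix.specialUnitaryGroup (Fin N) ℂ)) (e : PBond P j)
    {s₀ : ℝ} (hs₀ : 0 ≤ s₀) (hbudget : 6400 * (((P.d + 2) * P.L : ℕ) : ℝ) ^ 2 * (P.L : ℝ) ^ j * s₀ ≤ 1)
    (hguard : 30 * (((P.d + 2) * P.L : ℕ) : ℝ) ^ 2 * (P.L : ℝ) ^ j * s₀ < deltaSU (Fin N))
    (hU : ∀ b : PBond P 0, (iterBlockOf j b.src = e.src ∨ iterBlockOf j b.src = e.tgt) →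
      ‖((U b : Matrix.specialUnitaryGroup (Fin N) ℂ) : Matrix (Fin N) (Fin N) ℂ) - 1‖ ≤ s₀) :
    ∀ i : ℕ, i ≤ j → ∀ b : PBond P i,
      (∀ x : Site P 0, iterBlockOf i x = b.src → (iterBlockOf j x = e.src ∨ iterBlockOf j x = e.tgt)) →
      (∀ x : Site P 0, iterBlockOf i x = b.tgt → (iterBlockOf j x = e.src ∨ iterBlockOf j x = e.tgt)) →
      emlIterU i (unitsField (toUField U)) b =
          unitsField (toUField (Averaging.iter (fun _ => blockAvg expMeanLogSU) i U)) b ∧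
        ‖((Averaging.iter (fun _ => blockAvg expMeanLogSU) i U b : Matrix.specialUnitaryGroup (Fin N) ℂ) : Matrix (Fin N) (Fin N) ℂ) - 1‖ ≤
          30 * (((P.d + 2) * P.L : ℕ) : ℝ) * (P.L : ℝ) ^ i * s₀ := by
  set ℓ : ℝ := (((P.d + 2) * P.L : ℕ) : ℝ) with hℓ
  have hL1 : (1 : ℝ) ≤ P.L := by exact_mod_cast P.L_pos
  have hℓ1 : (1 : ℝ) ≤ ℓ := by
    rw [hℓ]; exact_mod_cast Nat.one_le_iff_ne_zero.mpr (Nat.mul_ne_zero (by omega) (by have := P.hL.2; omega))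
  -- the window of `e` at level `i`: sites all of whose fine sites have their `j`-block point among the ends of `e`
  set T : (i : ℕ) → Set (Site P i) := fun i => {y | ∀ x : Site P 0, iterBlockOf i x = y → (iterBlockOf j x = e.src ∨ iterBlockOf j x = e.tgt)} with hT
  -- closure of the window under one block step
  have hTstep : ∀ (i : ℕ) (y : Site P i) (z : Site P (i + 1)), z ∈ T (i + 1) → blockOf y = z → y ∈ T i := by
    intro i y z hz hyz x hx
    exact hz x (by rw [iterBlockOf_succ, hx, hyz])
  -- the k-uniform near-flatness of pillar P3 on the window (any level `i ≤ j`)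
  have hnear : ∀ i : ℕ, i ≤ j → ∀ b : PBond P i, b.src ∈ T i → b.tgt ∈ T i →
      ‖((emlIterU i (unitsField (toUField U)) b : (Matrix (Fin N) (Fin N) ℂ)ˣ) : Matrix (Fin N) (Fin N) ℂ) - 1‖ ≤ 30 * ℓ * (P.L : ℝ) ^ i * s₀ := by
    intro i hi b hs ht
    have hbud : 6400 * ℓ ^ 2 * (P.L : ℝ) ^ i * s₀ ≤ 1 := by
      have hpow : (P.L : ℝ) ^ i ≤ (P.L : ℝ) ^ j := pow_le_pow_right₀ hL1 hi
      have : 6400 * ℓ ^ 2 * (P.L : ℝ) ^ i * s₀ ≤ 6400 * ℓ ^ 2 * (P.L : ℝ) ^ j * s₀ :=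
        mul_le_mul_of_nonneg_right (mul_le_mul_of_nonneg_left hpow (by positivity)) hs₀
      exact this.trans hbudget
    refine norm_emlIterU_sub_one_le_of_reads (hi.trans hj) (T i) (unitsField (toUField U)) hs₀ hbud (fun b₀ hb₀ _ => ?_) b hs ht
    rw [val_unitsField]
    exact hU b₀ (hb₀ b₀.src rfl)
  -- the induction over the levels
  intro i
  induction i with
  | zero =>
    intro _ b hs _
    refine ⟨rfl, ?_⟩
    have h := hU b (hs b.src rfl)
    have h1 : s₀ ≤ 30 * ℓ * (P.L : ℝ) ^ 0 * s₀ := by rw [pow_zero, mul_one]; nlinarith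
    exact h.trans h1
  | succ i ih =>
    intro hi1 c hcs hct
    have hi : i ≤ j := Nat.le_of_succ_le hi1
    have hi1' : i + 1 ≤ P.m + P.K := hi1.trans hj
    -- the inductive identity on the two blocks of `c`
    have IHw : ∀ b : PBond P i, (blockOf b.src = c.src ∨ blockOf b.src = c.tgt) → (blockOf b.tgt = c.src ∨ blockOf b.tgt = c.tgt) →
        b.src ∈ T i ∧ b.tgt ∈ T i := by
      intro b hbs hbt
      refine ⟨?_, ?_⟩
      · rcases hbs with h | h
        · exact hTstep i b.src c.src hcs h
        · exact hTstep i b.src c.tgt hct h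
      · rcases hbt with h | h
        · exact hTstep i b.tgt c.src hcs h
        · exact hTstep i b.tgt c.tgt hct h
    have heq : ∀ b : PBond P i, (blockOf b.src = c.src ∨ blockOf b.src = c.tgt) → (blockOf b.tgt = c.src ∨ blockOf b.tgt = c.tgt) →
        emlIterU i (unitsField (toUField U)) b = unitsField (toUField (Averaging.iter (fun _ => blockAvg expMeanLogSU) i U)) b :=
      fun b hbs hbt => (ih hi b (IHw b hbs hbt).1 (IHw b hbs hbt).2).1
    -- the guard at `c` for the level-`i` guarded average
    have hsmall : Small (expMeanLogSU (n := Fin N)) (Averaging.iter (fun _ => blockAvg expMeanLogSU) i U) c := by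
      intro idx
      show dist1 (holAt (Averaging.iter (fun _ => blockAvg expMeanLogSU) i U) (walk (emb c.src) (loopWord P.L c.dir (off idx.1) idx.2.1 idx.2.2))) <
        (expMeanLogSU (n := Fin N)).δ
      rw [expMeanLogSU_δ]
      have hsteps : ∀ s ∈ walk (emb c.src) (loopWord P.L c.dir (off idx.1) idx.2.1 idx.2.2),
          dist1 (Averaging.iter (fun _ => blockAvg expMeanLogSU) i U s.bond) ≤ 30 * ℓ * (P.L : ℝ) ^ i * s₀ := by
        intro s hs
        have hbs := blockOf_src_of_mem_walk hi1' c idx s hs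
        have hbt := T4ReflectionConeSharp.blockOf_tgt_of_mem_walk hi1' c idx s hs
        obtain ⟨hsT, htT⟩ := IHw s.bond hbs hbt
        have h := hnear i hi s.bond hsT htT
        rw [heq s.bond hbs hbt, val_unitsField] at h
        exact h
      have hlen : ((walk (emb c.src) (loopWord P.L c.dir (off idx.1) idx.2.1 idx.2.2)).length : ℝ) ≤ ℓ := by
        rw [length_walk, hℓ]
        exact_mod_cast length_loopWord_le c idx
      have hpow : (P.L : ℝ) ^ i ≤ (P.L : ℝ) ^ j := pow_le_pow_right₀ hL1 hi
      calc dist1 (holAt (Averaging.iter (fun _ => blockAvg expMeanLogSU) i U) (walk (emb c.src) (loopWord P.L c.dir (off idx.1) idx.2.1 idx.2.2)))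
          ≤ ((walk (emb c.src) (loopWord P.L c.dir (off idx.1) idx.2.1 idx.2.2)).length : ℝ) * (30 * ℓ * (P.L : ℝ) ^ i * s₀) :=
            dist1_holAt_le_length_mul _ _ hsteps
        _ ≤ ℓ * (30 * ℓ * (P.L : ℝ) ^ j * s₀) := by
            refine mul_le_mul hlen (mul_le_mul_of_nonneg_right (mul_le_mul_of_nonneg_left hpow (by positivity)) hs₀) (by positivity) (by positivity)
        _ = 30 * ℓ ^ 2 * (P.L : ℝ) ^ j * s₀ := by ring
        _ < deltaSU (Fin N) := hguard
        _ = min (1 / 3) (Real.pi / Fintype.card (Fin N)) := rfl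
    -- one step: locality, then the one-step dictionary on the guard
    have hstep : emlIterU (i + 1) (unitsField (toUField U)) c =
        unitsField (toUField (Averaging.iter (fun _ => blockAvg expMeanLogSU) (i + 1) U)) c := by
      rw [emlIterU_succ, emlAvgU_congr₂ hi1' c heq]
      apply Units.ext
      rw [coe_emlAvgU_unitsField _ c hsmall, val_unitsField]
      rfl
    refine ⟨hstep, ?_⟩
    have h := hnear (i + 1) hi1 c hcs hct
    rw [hstep, val_unitsField] at h
    exact h

end Dictionary

/-! ## §2 The chart's data are Hermitian traceless for Hermitian traceless `A` on the weighted ball -/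

section Chart

variable {N : ℕ} [NeZero N]

omit [NeZero N] in
/-- `iη·A(b) ∈ 𝔰𝔲(N)` for Hermitian traceless `A(b)`. [cite: Balaban1985Variational, (152) p.301] -/
theorem I_eta_smul_mem_lieSU (η : ℝ) {X : Matrix (Fin N) (Fin N) ℂ} (hX : X ∈ herm0 (Fin N)) : (Complex.I * (η : ℂ)) • X ∈ lieSU (Fin N) := by
  obtain ⟨hh, htr⟩ := (mem_herm0).1 hX
  rw [mem_lieSU_iff]
  refine ⟨?_, by rw [Matrix.trace_smul, htr, smul_zero]⟩
  rw [Matrix.star_eq_conjTranspose, Matrix.conjTranspose_smul, hh.eq, ← neg_smul]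
  congr 1
  rw [star_mul', Complex.star_def, Complex.conj_I, Complex.conj_ofReal, neg_mul]

omit [NeZero N] in
/-- `(−i)·Y` is Hermitian traceless for `Y ∈ 𝔰𝔲(N)`. [cite: Balaban1985Variational, (156) p.302] -/
theorem neg_I_smul_mem_herm0 {Y : Matrix (Fin N) (Fin N) ℂ} (hY : Y ∈ lieSU (Fin N)) : (-Complex.I) • Y ∈ herm0 (Fin N) := by
  obtain ⟨hs, htr⟩ := mem_lieSU_iff.1 hY
  rw [mem_herm0]
  refine ⟨?_, by rw [Matrix.trace_smul, htr, smul_zero]⟩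
  show ((-Complex.I) • Y).conjTranspose = (-Complex.I) • Y
  rw [Matrix.conjTranspose_smul, ← Matrix.star_eq_conjTranspose, hs, star_neg, Complex.star_def, Complex.conj_I, neg_neg, smul_neg, ← neg_smul]

/-- ★ **THE CHARTED FIELD'S COMPLEX AVERAGES ARE THE GUARDED `SU(N)` AVERAGES OF `e^{iηA}`** at every index bond, on the weighted ball with the guard budget: for Hermitian
traceless `A` with `w₁(b)‖A(b)‖ < R`, `12800ℓ²LR ≤ 1`, `60ℓ²LR < δ_N`, and ANY `SU(N)` field `U` whose matrices are the charted bond variables `e^{iηA(b)}`: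
`Ū^{(j)}(e^{iηA})(c) = Ū^{(j)}_{(0.4)}(U)(c)` (units of `M_N(ℂ)`), within `60ℓLR` of `1`. [cite: Balaban1985Variational, (152) (156) pp.301-302; Balaban1987RG1, (0.4) (0.11) p.253] -/
theorem coe_emlIterU_expCfg_eq_iter (k : ℕ) (D : Domains P) (hDk : D.k = k)
    (hcollar : ∀ (i : ℕ) (e : PBond P (i + 1)), D.LamBond (i + 1) e → ∀ z : Site P i, (blockOf z = e.src ∨ blockOf z = e.tgt) → z ∈ D.Om i)
    {w : ℕ → PBond P 0 → ℝ} (hw : IsLevWeight P k D w) {R : ℝ} (hR : 12800 * (((P.d + 2) * P.L : ℕ) : ℝ) ^ 2 * (P.L : ℝ) * R ≤ 1)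
    (hguard : 60 * (((P.d + 2) * P.L : ℕ) : ℝ) ^ 2 * (P.L : ℝ) * R < deltaSU (Fin N))
    {A : PBond P 0 → Matrix (Fin N) (Fin N) ℂ} (hA : ∀ b, w 1 b * ‖A b‖ < R)
    (U : GaugeField P 0 (Matrix.specialUnitaryGroup (Fin N) ℂ))
    (hUA : ∀ b, ((U b : Matrix.specialUnitaryGroup (Fin N) ℂ) : Matrix (Fin N) (Fin N) ℂ) = ((expCfg (((P.L : ℝ)⁻¹) ^ k) A b : (Matrix (Fin N) (Fin N) ℂ)ˣ) : _))
    (idx : BondIdx D) :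
    emlIterU (idx.1.1 : ℕ) (expCfg (((P.L : ℝ)⁻¹) ^ k) A) idx.1.2 =
        unitsField (toUField (Averaging.iter (fun _ => blockAvg expMeanLogSU) (idx.1.1 : ℕ) U)) idx.1.2 ∧
      ‖((Averaging.iter (fun _ => blockAvg expMeanLogSU) (idx.1.1 : ℕ) U idx.1.2 : Matrix.specialUnitaryGroup (Fin N) ℂ) : Matrix (Fin N) (Fin N) ℂ) - 1‖ ≤
        60 * (((P.d + 2) * P.L : ℕ) : ℝ) * (P.L : ℝ) * R := by
  set ℓ : ℝ := (((P.d + 2) * P.L : ℕ) : ℝ) with hℓ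
  have hL1 : (1 : ℝ) ≤ P.L := by exact_mod_cast P.L_pos
  have hL0 : (0 : ℝ) < P.L := by linarith
  have hLj : 0 < (P.L : ℝ) ^ (idx.1.1 : ℕ) := by positivity
  have hℓ1 : (1 : ℝ) ≤ ℓ := by
    rw [hℓ]; exact_mod_cast Nat.one_le_iff_ne_zero.mpr (Nat.mul_ne_zero (by omega) (by have := P.hL.2; omega))
  have hR0 : 0 ≤ R := by
    have := hA ⟨fun _ => 0, idx.1.2.dir⟩
    have hw0 : 0 ≤ w 1 ⟨fun _ => 0, idx.1.2.dir⟩ * ‖A ⟨fun _ => 0, idx.1.2.dir⟩‖ := by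
      rw [hw 1, pow_one]; exact mul_nonneg (by positivity) (norm_nonneg _)
    linarith
  -- the charted field is this `SU(N)` field read in the units
  have hUexp : unitsField (toUField U) = expCfg (((P.L : ℝ)⁻¹) ^ k) A := by
    funext b; apply Units.ext; rw [val_unitsField]; exact hUA b
  -- reads of the index: within `s₀ = 2LR/Lʲ` of `1`
  set s₀ : ℝ := 2 * (P.L : ℝ) * R * ((P.L : ℝ) ^ (idx.1.1 : ℕ))⁻¹ with hs₀
  have hs₀0 : 0 ≤ s₀ := by positivity
  have hreads : ∀ b : PBond P 0, (iterBlockOf (idx.1.1 : ℕ) b.src = idx.1.2.src ∨ iterBlockOf (idx.1.1 : ℕ) b.src = idx.1.2.tgt) →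
      ‖((U b : Matrix.specialUnitaryGroup (Fin N) ℂ) : Matrix (Fin N) (Fin N) ℂ) - 1‖ ≤ s₀ := by
    intro b hb
    rw [hUA b]
    exact norm_expCfg_sub_one_le_of_weightedBall k D hDk hcollar hw hR hA idx b hb
  have hbudget : 6400 * ℓ ^ 2 * (P.L : ℝ) ^ (idx.1.1 : ℕ) * s₀ ≤ 1 := by
    have : 6400 * ℓ ^ 2 * (P.L : ℝ) ^ (idx.1.1 : ℕ) * s₀ = 12800 * ℓ ^ 2 * (P.L : ℝ) * R := by
      rw [hs₀]; field_simp; ring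
    rw [this]; exact hR
  have hguard' : 30 * ℓ ^ 2 * (P.L : ℝ) ^ (idx.1.1 : ℕ) * s₀ < deltaSU (Fin N) := by
    have : 30 * ℓ ^ 2 * (P.L : ℝ) ^ (idx.1.1 : ℕ) * s₀ = 60 * ℓ ^ 2 * (P.L : ℝ) * R := by
      rw [hs₀]; field_simp; ring
    rw [this]; exact hguard
  have hj : (idx.1.1 : ℕ) ≤ P.m + P.K := (D.le_of_lamBond idx.2).trans D.hk
  obtain ⟨heq, hnorm⟩ := emlIterU_unitsField_eq_iter_of_reads hj U idx.1.2 hs₀0 hbudget hguard' hreads (idx.1.1 : ℕ) le_rfl idx.1.2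
    (fun x hx => by rw [← hx]; exact Or.inl rfl) (fun x hx => by rw [← hx]; exact Or.inr rfl)
  rw [hUexp] at heq
  refine ⟨heq, hnorm.trans (le_of_eq ?_)⟩
  rw [hs₀, hℓ]; field_simp; ring

/-- ★★★ **REALITY OF THE CHART: `chartLog η D A (j, c)` IS HERMITIAN TRACELESS FOR HERMITIAN TRACELESS `A` ON THE WEIGHTED BALL** (`12800ℓ²LR ≤ 1`, guard budget `60ℓ²LR < δ_N`):
«B = (1∕i) log Ū^{(j)}(e^{iηA})» with `Ū^{(j)}(e^{iηA})(c) ∈ SU(N)` (§1's dictionary) within `60ℓLR ≤ 1∕4` of `1` and `N·60ℓLR < N·δ_N ≤ π`, so `log` of it is in `𝔰𝔲(N)`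
(`star_mlog_eq_neg`, `trace_mlog_eq_zero`) and `(−i)·log` is Hermitian traceless. [cite: Balaban1985Variational, (152) (156) pp.301-302; Balaban1985Averaging, (20)-(26) pp.21-22] -/
theorem chartLog_mem_herm0 (k : ℕ) (D : Domains P) (hDk : D.k = k)
    (hcollar : ∀ (i : ℕ) (e : PBond P (i + 1)), D.LamBond (i + 1) e → ∀ z : Site P i, (blockOf z = e.src ∨ blockOf z = e.tgt) → z ∈ D.Om i)
    {w : ℕ → PBond P 0 → ℝ} (hw : IsLevWeight P k D w) {R : ℝ} (hR : 12800 * (((P.d + 2) * P.L : ℕ) : ℝ) ^ 2 * (P.L : ℝ) * R ≤ 1)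
    (hguard : 60 * (((P.d + 2) * P.L : ℕ) : ℝ) ^ 2 * (P.L : ℝ) * R < deltaSU (Fin N))
    {A : PBond P 0 → Matrix (Fin N) (Fin N) ℂ} (hA : ∀ b, w 1 b * ‖A b‖ < R) (hAh : ∀ b, A b ∈ herm0 (Fin N)) (idx : BondIdx D) :
    chartLog (((P.L : ℝ)⁻¹) ^ k) D A idx ∈ herm0 (Fin N) := by
  set ℓ : ℝ := (((P.d + 2) * P.L : ℕ) : ℝ) with hℓ
  have hL1 : (1 : ℝ) ≤ P.L := by exact_mod_cast P.L_pos
  have hℓ1 : (1 : ℝ) ≤ ℓ := by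
    rw [hℓ]; exact_mod_cast Nat.one_le_iff_ne_zero.mpr (Nat.mul_ne_zero (by omega) (by have := P.hL.2; omega))
  have hR0 : 0 ≤ R := by
    have := hA ⟨fun _ => 0, idx.1.2.dir⟩
    have hw0 : 0 ≤ w 1 ⟨fun _ => 0, idx.1.2.dir⟩ * ‖A ⟨fun _ => 0, idx.1.2.dir⟩‖ := by
      rw [hw 1, pow_one]; exact mul_nonneg (by positivity) (norm_nonneg _)
    linarith
  -- the `SU(N)` field `e^{iηA}`
  set U : GaugeField P 0 (Matrix.specialUnitaryGroup (Fin N) ℂ) := fun b =>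
    ⟨exp ((Complex.I * ((((P.L : ℝ)⁻¹) ^ k : ℝ) : ℂ)) • A b), exp_mem_specialUnitaryGroup_of_mem_lieSU (I_eta_smul_mem_lieSU _ (hAh b))⟩ with hU
  have hUA : ∀ b, ((U b : Matrix.specialUnitaryGroup (Fin N) ℂ) : Matrix (Fin N) (Fin N) ℂ) =
      ((expCfg (((P.L : ℝ)⁻¹) ^ k) A b : (Matrix (Fin N) (Fin N) ℂ)ˣ) : _) := fun b => by rw [coe_expCfg]
  obtain ⟨heq, hnorm⟩ := coe_emlIterU_expCfg_eq_iter k D hDk hcollar hw hR hguard hA U hUA idx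
  set M : Matrix.specialUnitaryGroup (Fin N) ℂ := Averaging.iter (fun _ => blockAvg expMeanLogSU) (idx.1.1 : ℕ) U idx.1.2 with hM
  have hval : ((emlIterU (idx.1.1 : ℕ) (expCfg (((P.L : ℝ)⁻¹) ^ k) A) idx.1.2 : (Matrix (Fin N) (Fin N) ℂ)ˣ) : Matrix (Fin N) (Fin N) ℂ) =
      (M : Matrix (Fin N) (Fin N) ℂ) := by
    rw [heq, val_unitsField]; rfl
  -- the sizes feeding the logarithm
  have h60 : 60 * ℓ * (P.L : ℝ) * R ≤ 60 * ℓ ^ 2 * (P.L : ℝ) * R := by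
    have h0 : 0 ≤ 60 * (P.L : ℝ) * R := by positivity
    have hℓsq : ℓ ≤ ℓ ^ 2 := by nlinarith
    calc 60 * ℓ * (P.L : ℝ) * R = (60 * (P.L : ℝ) * R) * ℓ := by ring
      _ ≤ (60 * (P.L : ℝ) * R) * ℓ ^ 2 := mul_le_mul_of_nonneg_left hℓsq h0
      _ = 60 * ℓ ^ 2 * (P.L : ℝ) * R := by ring
  have hquarter : 60 * ℓ * (P.L : ℝ) * R ≤ 1 / 4 := h60.trans (by linarith)
  have hδ3 : deltaSU (Fin N) ≤ 1 / 3 := min_le_left _ _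
  have hδπ : deltaSU (Fin N) ≤ Real.pi / Fintype.card (Fin N) := min_le_right _ _
  have hM4 : ‖(M : Matrix (Fin N) (Fin N) ℂ) - 1‖ ≤ 1 / 4 := hnorm.trans hquarter
  have hM3 : ‖(M : Matrix (Fin N) (Fin N) ℂ) - 1‖ ≤ 1 / 3 := hM4.trans (by norm_num)
  have hcard : (0 : ℝ) < Fintype.card (Fin N) := by
    rw [Fintype.card_fin]; exact_mod_cast Nat.pos_of_ne_zero (NeZero.ne N)
  have hMπ : Fintype.card (Fin N) * ‖(M : Matrix (Fin N) (Fin N) ℂ) - 1‖ < Real.pi := by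
    have h1 : ‖(M : Matrix (Fin N) (Fin N) ℂ) - 1‖ < deltaSU (Fin N) := lt_of_le_of_lt (hnorm.trans h60) hguard
    have h2 : (Fintype.card (Fin N) : ℝ) * deltaSU (Fin N) ≤ Real.pi := by
      rw [← le_div_iff₀' hcard]; exact hδπ
    exact lt_of_lt_of_le (mul_lt_mul_of_pos_left h1 hcard) h2
  -- `log M ∈ 𝔰𝔲(N)`
  have hlog : mlog (M : Matrix (Fin N) (Fin N) ℂ) ∈ lieSU (Fin N) := by
    letI : CStarAlgebra (Matrix (Fin N) (Fin N) ℂ) := {}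
    rw [mem_lieSU_iff]
    exact ⟨B7Prop2Explicit.star_mlog_eq_neg M.2.1 hM4, trace_mlog_eq_zero M.2 hM3 hMπ⟩
  rw [chartLog_apply, hval]
  exact neg_I_smul_mem_herm0 hlog

end Chart

/-! ## §3 (hSlog) discharged at `𝔤 = herm0`: reality of the chart `D(·)` for Hermitian traceless data -/

section Reality

variable {N : ℕ} [NeZero N]

/-- ★★★ **REALITY OF PROP. 3's CHART AT PRINT'S `𝔤`.**  Under the binders of `N07ChartDValued.chartD_valued_of_chartLog` — a (2.2)-admissible nested family, level weights, a ℂ-linear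
`H` with the weighted (46) letter `B₀`, the window `18C₂B₀ε ≤ 1`, `64ε ≤ R⋆` — plus the value-module conjunct (hSH) of `H` at `herm0` (DISPLAYED) and the guard budget
`120ℓ²Lε < δ_N`: for ANY `Dfun` obeying (55) and (49) on the weighted `ε`-ball and every Hermitian-traceless-valued `A′` in the ball, `Dfun A′` and `A′ − H·Dfun A′` are Hermitian
traceless — (hSlog) being §2 on the `2ε`-ball. [cite: Balaban1985Variational, (47)-(55) pp.285-286, Prop. 3 p.289, (152) (156) pp.301-302; Balaban1985RegularSpaces, p.93] -/
theorem chartD_valued_herm0 (k : ℕ) {R' M : ℕ} (hR'L : 2 * P.L ≤ R') (hM : 1 ≤ M) (D : Domains P) (hDk : D.k = k) (hAdm : Adm22 D R' M)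
    {w : ℕ → PBond P 0 → ℝ} (hw : IsLevWeight P k D w)
    (H : (BondIdx D → Matrix (Fin N) (Fin N) ℂ) →ₗ[ℂ] (PBond P 0 → Matrix (Fin N) (Fin N) ℂ)) {B₀ : ℝ} (hB₀ : 0 ≤ B₀)
    (hHB : ∀ (X : BondIdx D → Matrix (Fin N) (Fin N) ℂ) (t : ℝ), 0 ≤ t → (∀ i, ‖X i‖ ≤ t) → ∀ b, w 1 b * ‖H X b‖ ≤ B₀ * t)
    {ε : ℝ} (hε : 0 < ε)
    (h18 : 18 * (960 * (((P.d + 2) * P.L : ℕ) : ℝ) * (P.L : ℝ) / (12800 * (((P.d + 2) * P.L : ℕ) : ℝ) ^ 2 * (P.L : ℝ))⁻¹) * B₀ * ε ≤ 1)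
    (h2 : 64 * ε ≤ (12800 * (((P.d + 2) * P.L : ℕ) : ℝ) ^ 2 * (P.L : ℝ))⁻¹)
    (hδ : 120 * (((P.d + 2) * P.L : ℕ) : ℝ) ^ 2 * (P.L : ℝ) * ε < deltaSU (Fin N))
    (hSH : ∀ X : BondIdx D → Matrix (Fin N) (Fin N) ℂ, (∀ i, X i ∈ herm0 (Fin N)) → ∀ b, H X b ∈ herm0 (Fin N))
    (Dfun : (PBond P 0 → Matrix (Fin N) (Fin N) ℂ) → (BondIdx D → Matrix (Fin N) (Fin N) ℂ))
    (h55 : ∀ A' : PBond P 0 → Matrix (Fin N) (Fin N) ℂ, (∀ b, w 1 b * ‖A' b‖ < ε) →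
      ∀ (ρ : ℝ), 0 ≤ ρ → (∀ b, w 1 b * ‖A' b‖ ≤ ρ) →
        ∀ i, ‖Dfun A' i‖ ≤ 4 * (960 * (((P.d + 2) * P.L : ℕ) : ℝ) * (P.L : ℝ) / (12800 * (((P.d + 2) * P.L : ℕ) : ℝ) ^ 2 * (P.L : ℝ))⁻¹) * ρ ^ 2)
    (h49 : ∀ A' : PBond P 0 → Matrix (Fin N) (Fin N) ℂ, (∀ b, w 1 b * ‖A' b‖ < ε) →
      chartLog (((P.L : ℝ)⁻¹) ^ k) D (A' - H (Dfun A')) -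
        (fderiv ℂ (chartLog (((P.L : ℝ)⁻¹) ^ k) D : (PBond P 0 → Matrix (Fin N) (Fin N) ℂ) → BondIdx D → Matrix (Fin N) (Fin N) ℂ) 0) (A' - H (Dfun A')) =
          Dfun A')
    (A' : PBond P 0 → Matrix (Fin N) (Fin N) ℂ) (hA' : ∀ b, w 1 b * ‖A' b‖ < ε) (hA'h : ∀ b, A' b ∈ herm0 (Fin N)) :
    (∀ i, Dfun A' i ∈ herm0 (Fin N)) ∧ ∀ b, (A' - H (Dfun A')) b ∈ herm0 (Fin N) := by
  have hL1 : (1 : ℝ) ≤ P.L := by exact_mod_cast P.L_pos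
  have hℓ1 : (1 : ℝ) ≤ (((P.d + 2) * P.L : ℕ) : ℝ) := by
    exact_mod_cast Nat.one_le_iff_ne_zero.mpr (Nat.mul_ne_zero (by omega) (by have := P.hL.2; omega))
  have hden : 0 < 12800 * (((P.d + 2) * P.L : ℕ) : ℝ) ^ 2 * (P.L : ℝ) := by positivity
  have hRM : 2 * P.L ≤ R' * M + 1 := by have : R' ≤ R' * M := Nat.le_mul_of_pos_right R' hM; omega
  have hcollar := collar_of_adm22 D hAdm hRM
  -- the `2ε`-ball is inside the `R⋆`-budget: `12800ℓ²L·(2ε) ≤ 1/32 ≤ 1`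
  have hR2 : 12800 * (((P.d + 2) * P.L : ℕ) : ℝ) ^ 2 * (P.L : ℝ) * (2 * ε) ≤ 1 := by
    have h := mul_le_mul_of_nonneg_left h2 hden.le
    rw [mul_inv_cancel₀ hden.ne'] at h
    nlinarith
  have hguard : 60 * (((P.d + 2) * P.L : ℕ) : ℝ) ^ 2 * (P.L : ℝ) * (2 * ε) < deltaSU (Fin N) := by nlinarith
  exact chartD_valued_of_chartLog k hR'L hM D hDk hAdm hw H hB₀ hHB hε h18 h2 (herm0 (Fin N)) hSH
    (fun Y hY hYh i => chartLog_mem_herm0 k D hDk hcollar hw hR2 hguard hY hYh i) Dfun h55 h49 A' hA' hA'h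

end Reality

end Summit.QuantumFields.YangMills.BalabanUVNodes.N07ChartLogReality

end
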